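import Literature.AlgebraicGeometry.Frobenioids.Thm42Assembly
import Literature.AlgebraicGeometry.Frobenioids.EquivalenceThm34iiiOfPreSteps
import HarnessLib

/-!
# [FrdI] Theorem 4.2 (i)(ii)(iii) AS TYPED (perfect-type case) from Theorem 3.4 (ii) alone — base-free
# assembly — and over bases of FSMFF-type in the author's revised (2024) sense

Mochizuki, *The geometry of Frobenioids I: the general theory*, Kyushu J. Math. **62** (2008)
293–400, §4, Theorem 4.2, statement p. 77 l. 23 – p. 78, proof p. 78 l. 28 – p. 81
[cite: MochizukiFrdI2008, Thm. 4.2 p.77]; Theorem 3.4 (ii)(iii) p. 62; condition (b) of "FSMFF-type" as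
revised by the author (*Comments*, January 2024, item (28)) [cite: MochizukiFrdIComments2024, (28) p.3].

PROOF-ONLY file (seat abc-iut-L1-t11; sub-DAG `plan/L1/SUBDAG-FrdI-Thm42-Thm49.md` row T42-L00 × the
"FSMFF-2024" axis of GAP-LEDGER row G-L1d8-1). Seat abc-iut-w5-d162's `Thm42Assembly.lean` derives the
setting `FrdI.T42.Setting` of the proof of Thm. 4.2 — whose Thm. 3.4 fields are "`Ψ`, `Ψ⁻¹` preserve
pre-steps, steps, Frobenius type, Frobenius degrees, pull-backs" — over bases of FSM-type
(`setting_of_isOfFSMType`, abc-iut-L1-t13's FSM theorems). In print these fields are Thm. 3.4 (ii) and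
"(iii) follows formally from (ii)" (p. 64); abc-iut-L1-t11's (ii)-agnostic chain (`FrdI.OfPreSteps.*`,
`EquivalenceFrobeniusOfPreSteps.lean` … `EquivalenceFrobeniusQuasiIsotropicOfPreSteps.lean`) makes that
kernel-precise. Hence, importing every T42 row BY NAME and re-proving nothing:

* `PreFrobenioidData.setting_of_preservesPreSteps` — the setting from `Thm42Setting` + perfect type +
  `Φ_i` perf-factorial + **"`Ψ`, `Ψ⁻¹` preserve pre-steps" ONLY (NO hypothesis on the base categories)**;
  `thm42i/ii/iii/ii_iii_of_perfectType_of_preservesPreSteps` — the typed `Thm42i` / `Thm42ii` / `Thm42iii`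
  (abc-iut-L1-t3) then follow by abc-iut-w5-d162's `thm42*_of_perfectSetting`;
* `PreFrobenioidData.setting_of_isOfFSMFFType2024` and `thm42i/ii/iii/ii_iii_of_perfectType_of_isOfFSMFFType2024`
  — over bases of FSMFF-type in the REVISED sense (⊋ FSM-type; e.g. the archimedean base categories of
  [FrdII] §3), pre-steps being preserved there by abc-iut-L1-t11's `FrdI.isPreStep_map_of_isOfFSMFFType2024`
  (the printed route through the revised Prop. 1.14 (iii)): **NO Thm. 3.4 / Thm. 4.2 hypothesis left**.
Honest residue unchanged from `Thm42Assembly.lean`: "standard type" vs "perfect type" (row L03, sub-DAG S7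
P55-L06) and the 2008-wording residual of Thm. 3.4 (ii) on FSMFF-2008 ∖ FSMFF-2024 bases. No new definition;
no statement of the paper is restated or strengthened; nothing here bears on [IUTchIII] Cor. 3.12.
-/

namespace Literature.AlgebraicGeometry.Frobenioids

open CategoryTheory Opposite

universe w v v' u u'

namespace PreFrobenioidData

variable {D : Type u} [Category.{v} D] {Φ : Dᵒᵖ ⥤ CommMonCat.{w}} {C : Type u'} [Category.{v'} C]
  {F : C ⥤ ElemFrobenioid Φ}
  {D₂ : Type u} [Category.{v} D₂] {Φ₂ : D₂ᵒᵖ ⥤ CommMonCat.{w}} {C₂ : Type u'} [Category.{v'} C₂]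
  {F₂ : C₂ ⥤ ElemFrobenioid Φ₂} (Ψ : C ≌ C₂)

/-! ## 1. The setting from Thm. 3.4 (ii) alone (no hypothesis on the base categories) -/

/-- **The setting of the proof of Thm. 4.2 from "`Ψ`, `Ψ⁻¹` preserve pre-steps"**: for Frobenioids
`C_i → F_{Φ_i}` of PERFECT type with `Φ_i` perf-factorial, the hypotheses `Thm42Setting` of the typed statement
(standard + isotropic type, not of group-like type) and the conclusion of Thm. 3.4 (ii) for `Ψ` and `Ψ⁻¹`
(pre-steps preserved) supply every field of `FrdI.T42.Setting`: steps (reflection of isomorphisms), Frobenius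
type, Frobenius degrees and pull-backs by abc-iut-L1-t11's (ii)-agnostic Thm. 3.4 (iii) chain
(`FrdI.OfPreSteps.isFrobeniusType_map_quasiIsotropic` / `degFr_map` / `isPullbackMorphism_map_quasiIsotropic`;
standard type ⊇ quasi-isotropic (a) + non-dilating (e); "not of group-like type" = a non-group-like object on
each side). [cite: MochizukiFrdI2008, Thm. 3.4 (ii)(iii) p.62] -/
theorem setting_of_preservesPreSteps (hF : PreFrobenioid.IsFrobenioid F) (hF₂ : PreFrobenioid.IsFrobenioid F₂)
    (hperf : PreFrobenioid.IsOfPerfectType F) (hperf₂ : PreFrobenioid.IsOfPerfectType F₂)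
    (hpf : Objectwise (fun M _ => IsPerfFactorial M) Φ) (hpf₂ : Objectwise (fun M _ => IsPerfFactorial M) Φ₂)
    (hΨ : ∀ ⦃X Y : C⦄ (φ : X ⟶ Y),
      PreFrobenioid.IsPreStep F φ → PreFrobenioid.IsPreStep F₂ (Ψ.functor.map φ))
    (hΨ' : ∀ ⦃X Y : C₂⦄ (φ : X ⟶ Y),
      PreFrobenioid.IsPreStep F₂ φ → PreFrobenioid.IsPreStep F (Ψ.inverse.map φ))
    (hT : Thm42Setting (ofFunctor Φ F) (ofFunctor Φ₂ F₂)) :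
    FrdI.T42.Setting F F₂ Ψ := by
  have histr : PreFrobenioid.IsOfIsotropicType F := (ofFunctor_isOfIsotropicType F).mp hT.isotropic.1
  have histr₂ : PreFrobenioid.IsOfIsotropicType F₂ := (ofFunctor_isOfIsotropicType F₂).mp hT.isotropic.2
  have hq := hT.standard.1.quasiIsotropic
  have hq₂ := hT.standard.2.quasiIsotropic
  have hnd : Literature.AlgebraicGeometry.Frobenioids.IsNonDilatingOn Φ :=
    FrdI.isNonDilatingOn_of_ofFunctor hT.standard.1.nonDilating
  have hnd₂ : Literature.AlgebraicGeometry.Frobenioids.IsNonDilatingOn Φ₂ :=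
    FrdI.isNonDilatingOn_of_ofFunctor hT.standard.2.nonDilating
  obtain ⟨N₁, hN₁⟩ : ∃ A : C, ¬ PreFrobenioid.IsGroupLikeObj F A := by
    have h := hT.notGroupLike.1
    rw [isOfGroupLikeType_iff] at h
    simpa only [ofFunctor_isGroupLikeObj, not_forall] using h
  obtain ⟨N₂, hN₂⟩ : ∃ A : C₂, ¬ PreFrobenioid.IsGroupLikeObj F₂ A := by
    have h := hT.notGroupLike.2
    rw [isOfGroupLikeType_iff] at h
    simpa only [ofFunctor_isGroupLikeObj, not_forall] using h
  -- the implicit-binder forms consumed by the `FrdI.OfPreSteps` chain, for `Ψ` and for `Ψ⁻¹`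
  have h₁ : ∀ ⦃X Y : C⦄ ⦃φ : X ⟶ Y⦄,
      PreFrobenioid.IsPreStep F φ → PreFrobenioid.IsPreStep F₂ (Ψ.functor.map φ) := fun _ _ φ h => hΨ φ h
  have h₂ : ∀ ⦃X Y : C₂⦄ ⦃φ : X ⟶ Y⦄,
      PreFrobenioid.IsPreStep F₂ φ → PreFrobenioid.IsPreStep F (Ψ.inverse.map φ) := fun _ _ φ h => hΨ' φ h
  exact
    { isFrobenioid₁ := hF
      isFrobenioid₂ := hF₂
      perfect₁ := hperf
      perfect₂ := hperf₂
      isotropic₁ := histr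
      isotropic₂ := histr₂
      perfFactorial₁ := hpf
      perfFactorial₂ := hpf₂
      preStep_map := hΨ
      preStep_inv := hΨ'
      step_map := fun _ _ _ hφ => FrdI.OfPreSteps.isStep_map Ψ h₁ hφ
      step_inv := fun _ _ _ hφ => FrdI.OfPreSteps.isStep_map Ψ.symm h₂ hφ
      frobeniusType_map := fun _ _ _ hφ =>
        FrdI.OfPreSteps.isFrobeniusType_map_quasiIsotropic hF hF₂ hq hq₂ hnd hnd₂ Ψ h₁ h₂ hN₁ hN₂ hφ
      frobeniusType_inv := fun _ _ _ hφ =>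
        FrdI.OfPreSteps.isFrobeniusType_map_quasiIsotropic hF₂ hF hq₂ hq hnd₂ hnd Ψ.symm h₂ h₁ hN₂ hN₁ hφ
      degFr_map := fun _ _ φ => FrdI.OfPreSteps.degFr_map hF hF₂ hq hq₂ hnd hnd₂ Ψ h₁ h₂ hN₁ hN₂ φ
      pullback_map := fun _ _ _ hφ =>
        FrdI.OfPreSteps.isPullbackMorphism_map_quasiIsotropic hF hF₂ hq hq₂ hnd hnd₂ Ψ h₁ h₂ hN₁ hN₂ hφ
      pullback_inv := fun _ _ _ hφ =>
        FrdI.OfPreSteps.isPullbackMorphism_map_quasiIsotropic hF₂ hF hq₂ hq hnd₂ hnd Ψ.symm h₂ h₁ hN₂ hN₁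
          hφ }

/-- **Theorem 4.2 (i) AS TYPED, perfect-type case, from "`Ψ`, `Ψ⁻¹` preserve pre-steps" — no hypothesis on
the bases** (abc-iut-w5-d162's `thm42i_of_perfectSetting` on the setting above).
[cite: MochizukiFrdI2008, Thm. 4.2 (i) p.77] -/
theorem thm42i_of_perfectType_of_preservesPreSteps (hF : PreFrobenioid.IsFrobenioid F)
    (hF₂ : PreFrobenioid.IsFrobenioid F₂) (hperf : PreFrobenioid.IsOfPerfectType F)
    (hperf₂ : PreFrobenioid.IsOfPerfectType F₂) (hpf : Objectwise (fun M _ => IsPerfFactorial M) Φ)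
    (hpf₂ : Objectwise (fun M _ => IsPerfFactorial M) Φ₂)
    (hΨ : ∀ ⦃X Y : C⦄ (φ : X ⟶ Y),
      PreFrobenioid.IsPreStep F φ → PreFrobenioid.IsPreStep F₂ (Ψ.functor.map φ))
    (hΨ' : ∀ ⦃X Y : C₂⦄ (φ : X ⟶ Y),
      PreFrobenioid.IsPreStep F₂ φ → PreFrobenioid.IsPreStep F (Ψ.inverse.map φ)) :
    (ofFunctor Φ F).Thm42i (ofFunctor Φ₂ F₂) Ψ := fun hT =>
  thm42i_of_perfectSetting Ψ (setting_of_preservesPreSteps Ψ hF hF₂ hperf hperf₂ hpf hpf₂ hΨ hΨ' hT) hT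

/-- **Theorem 4.2 (ii) AS TYPED, perfect-type case, from "`Ψ`, `Ψ⁻¹` preserve pre-steps" — no hypothesis on
the bases.** [cite: MochizukiFrdI2008, Thm. 4.2 (ii) p.77] -/
theorem thm42ii_of_perfectType_of_preservesPreSteps (hF : PreFrobenioid.IsFrobenioid F)
    (hF₂ : PreFrobenioid.IsFrobenioid F₂) (hperf : PreFrobenioid.IsOfPerfectType F)
    (hperf₂ : PreFrobenioid.IsOfPerfectType F₂) (hpf : Objectwise (fun M _ => IsPerfFactorial M) Φ)
    (hpf₂ : Objectwise (fun M _ => IsPerfFactorial M) Φ₂)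
    (hΨ : ∀ ⦃X Y : C⦄ (φ : X ⟶ Y),
      PreFrobenioid.IsPreStep F φ → PreFrobenioid.IsPreStep F₂ (Ψ.functor.map φ))
    (hΨ' : ∀ ⦃X Y : C₂⦄ (φ : X ⟶ Y),
      PreFrobenioid.IsPreStep F₂ φ → PreFrobenioid.IsPreStep F (Ψ.inverse.map φ)) :
    (ofFunctor Φ F).Thm42ii (ofFunctor Φ₂ F₂) Ψ := fun hT =>
  thm42ii_of_perfectSetting Ψ (setting_of_preservesPreSteps Ψ hF hF₂ hperf hperf₂ hpf hpf₂ hΨ hΨ' hT) hT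

/-- **Theorem 4.2 (iii) AS TYPED, perfect-type case, from "`Ψ`, `Ψ⁻¹` preserve pre-steps"**, for ANY family `e`
satisfying the two clauses of (ii) — no hypothesis on the bases, no Thm. 3.4 (iii) / Thm. 4.2 (i) hypothesis.
[cite: MochizukiFrdI2008, Thm. 4.2 (iii) p.78] -/
theorem thm42iii_of_perfectType_of_preservesPreSteps (hF : PreFrobenioid.IsFrobenioid F)
    (hF₂ : PreFrobenioid.IsFrobenioid F₂) (hperf : PreFrobenioid.IsOfPerfectType F)
    (hperf₂ : PreFrobenioid.IsOfPerfectType F₂) (hpf : Objectwise (fun M _ => IsPerfFactorial M) Φ)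
    (hpf₂ : Objectwise (fun M _ => IsPerfFactorial M) Φ₂)
    (hΨ : ∀ ⦃X Y : C⦄ (φ : X ⟶ Y),
      PreFrobenioid.IsPreStep F φ → PreFrobenioid.IsPreStep F₂ (Ψ.functor.map φ))
    (hΨ' : ∀ ⦃X Y : C₂⦄ (φ : X ⟶ Y),
      PreFrobenioid.IsPreStep F₂ φ → PreFrobenioid.IsPreStep F (Ψ.inverse.map φ))
    (e : ∀ A : C, Primes (Φ.obj (op (PreFrobenioid.baseObj F A))) ≃
      Primes (Φ₂.obj (op (PreFrobenioid.baseObj F₂ (Ψ.functor.obj A)))))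
    (he : ∀ (A : C) (𝔭 : Primes (Φ.obj (op (PreFrobenioid.baseObj F A)))),
      (∀ ⦃B : C⦄ (φ : A ⟶ B), PreFrobenioid.IsCoAngularPreStep F φ →
          (PreFrobenioid.Div F φ ∈ 𝔭.submonoid ↔
            PreFrobenioid.Div F₂ (Ψ.functor.map φ) ∈ (e A 𝔭).submonoid)) ∧
        ∀ ⦃B : C⦄ (ψ : B ⟶ A), PreFrobenioid.IsCoAngularPreStep F ψ →
          ((∃ y ∈ 𝔭.submonoid, Frobenioids.pull Φ (PreFrobenioid.Base F ψ) y = PreFrobenioid.Div F ψ) ↔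
            ∃ y ∈ (e A 𝔭).submonoid, Frobenioids.pull Φ₂ (PreFrobenioid.Base F₂ (Ψ.functor.map ψ)) y =
              PreFrobenioid.Div F₂ (Ψ.functor.map ψ))) :
    (ofFunctor Φ F).Thm42iii (ofFunctor Φ₂ F₂) Ψ e := fun hT =>
  thm42iii_of_perfectSetting Ψ (setting_of_preservesPreSteps Ψ hF hF₂ hperf hperf₂ hpf hpf₂ hΨ hΨ' hT) e he hT

/-- **Theorem 4.2 (ii) and (iii) TOGETHER, perfect-type case, from "`Ψ`, `Ψ⁻¹` preserve pre-steps"**: the unique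
family `Ψ^Prime` of (ii) exists and, for IT, the monoid isomorphisms of (iii) exist at every
Div-Frobenius-trivial object — no family `e` assumed, no hypothesis on the bases.
[cite: MochizukiFrdI2008, Thm. 4.2 (ii)(iii) p.78] -/
theorem thm42ii_iii_of_perfectType_of_preservesPreSteps (hF : PreFrobenioid.IsFrobenioid F)
    (hF₂ : PreFrobenioid.IsFrobenioid F₂) (hperf : PreFrobenioid.IsOfPerfectType F)
    (hperf₂ : PreFrobenioid.IsOfPerfectType F₂) (hpf : Objectwise (fun M _ => IsPerfFactorial M) Φ)
    (hpf₂ : Objectwise (fun M _ => IsPerfFactorial M) Φ₂)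
    (hΨ : ∀ ⦃X Y : C⦄ (φ : X ⟶ Y),
      PreFrobenioid.IsPreStep F φ → PreFrobenioid.IsPreStep F₂ (Ψ.functor.map φ))
    (hΨ' : ∀ ⦃X Y : C₂⦄ (φ : X ⟶ Y),
      PreFrobenioid.IsPreStep F₂ φ → PreFrobenioid.IsPreStep F (Ψ.inverse.map φ))
    (hT : Thm42Setting (ofFunctor Φ F) (ofFunctor Φ₂ F₂)) :
    ∃ e : ∀ A : C, Primes (Φ.obj (op (PreFrobenioid.baseObj F A))) ≃
        Primes (Φ₂.obj (op (PreFrobenioid.baseObj F₂ (Ψ.functor.obj A)))),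
      (∀ (A : C) (𝔭 : Primes (Φ.obj (op (PreFrobenioid.baseObj F A)))),
        (∀ ⦃B : C⦄ (φ : A ⟶ B), PreFrobenioid.IsCoAngularPreStep F φ →
            (PreFrobenioid.Div F φ ∈ 𝔭.submonoid ↔
              PreFrobenioid.Div F₂ (Ψ.functor.map φ) ∈ (e A 𝔭).submonoid)) ∧
          ∀ ⦃B : C⦄ (ψ : B ⟶ A), PreFrobenioid.IsCoAngularPreStep F ψ →
            ((∃ y ∈ 𝔭.submonoid, Frobenioids.pull Φ (PreFrobenioid.Base F ψ) y = PreFrobenioid.Div F ψ) ↔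
              ∃ y ∈ (e A 𝔭).submonoid, Frobenioids.pull Φ₂ (PreFrobenioid.Base F₂ (Ψ.functor.map ψ)) y =
                PreFrobenioid.Div F₂ (Ψ.functor.map ψ))) ∧
      (ofFunctor Φ F).Thm42iii (ofFunctor Φ₂ F₂) Ψ e := by
  have S := setting_of_preservesPreSteps Ψ hF hF₂ hperf hperf₂ hpf hpf₂ hΨ hΨ' hT
  obtain ⟨e, he, -⟩ := PreFrobenioid.existsUnique_primesEquiv_family Ψ hF hF₂ hperf hperf₂ S.isotropic₁
    S.isotropic₂ hpf hpf₂ S.step_map S.step_inv S.preStep_map S.preStep_inv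
    (fun _ _ _ hφ => S.isPrimaryPreStep_map hφ) (fun _ _ _ hφ => S.isPrimaryPreStep_inverse_map hφ)
  exact ⟨e, he, thm42iii_of_perfectSetting Ψ S e he⟩

/-! ## 2. Bases of FSMFF-type in the author's revised (2024) sense -/

/-- **The setting of Thm. 4.2 over bases of FSMFF-type (revised)**: for Frobenioids of PERFECT type with `Φ_i`
perf-factorial over bases `D_i` with `IsOfFSMFFType2024 D_i`, `Thm42Setting` supplies every field of
`FrdI.T42.Setting` — pre-steps preserved by abc-iut-L1-t11's `FrdI.isPreStep_map_of_isOfFSMFFType2024` (the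
printed route of Thm. 3.4 (ii) through the revised Prop. 1.14 (iii)); twin of abc-iut-w5-d162's
`setting_of_isOfFSMType` (FSM ⇒ FSMFF-2024). [cite: MochizukiFrdI2008, Thm. 3.4 (ii)(iii) p.62]
[cite: MochizukiFrdIComments2024, (28) p.3] -/
theorem setting_of_isOfFSMFFType2024 (hF : PreFrobenioid.IsFrobenioid F) (hF₂ : PreFrobenioid.IsFrobenioid F₂)
    (hperf : PreFrobenioid.IsOfPerfectType F) (hperf₂ : PreFrobenioid.IsOfPerfectType F₂)
    (hpf : Objectwise (fun M _ => IsPerfFactorial M) Φ) (hpf₂ : Objectwise (fun M _ => IsPerfFactorial M) Φ₂)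
    (hD : IsOfFSMFFType2024 D) (hD₂ : IsOfFSMFFType2024 D₂)
    (hT : Thm42Setting (ofFunctor Φ F) (ofFunctor Φ₂ F₂)) : FrdI.T42.Setting F F₂ Ψ :=
  have histr : PreFrobenioid.IsOfIsotropicType F := (ofFunctor_isOfIsotropicType F).mp hT.isotropic.1
  have histr₂ : PreFrobenioid.IsOfIsotropicType F₂ := (ofFunctor_isOfIsotropicType F₂).mp hT.isotropic.2
  setting_of_preservesPreSteps Ψ hF hF₂ hperf hperf₂ hpf hpf₂
    (fun _ _ _ hφ => FrdI.isPreStep_map_of_isOfFSMFFType2024 hF hF₂ histr histr₂ hD hD₂ Ψ hφ)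
    (fun _ _ _ hφ => FrdI.isPreStep_map_of_isOfFSMFFType2024 hF₂ hF histr₂ histr hD₂ hD Ψ.symm hφ) hT

/-- **Theorem 4.2 (i) AS TYPED over bases of FSMFF-type (revised), perfect-type case — NO Thm. 3.4 / Thm. 4.2
hypothesis left.** [cite: MochizukiFrdI2008, Thm. 4.2 (i) p.77] [cite: MochizukiFrdIComments2024, (28) p.3] -/
theorem thm42i_of_perfectType_of_isOfFSMFFType2024 (hF : PreFrobenioid.IsFrobenioid F)
    (hF₂ : PreFrobenioid.IsFrobenioid F₂) (hperf : PreFrobenioid.IsOfPerfectType F)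
    (hperf₂ : PreFrobenioid.IsOfPerfectType F₂) (hpf : Objectwise (fun M _ => IsPerfFactorial M) Φ)
    (hpf₂ : Objectwise (fun M _ => IsPerfFactorial M) Φ₂) (hD : IsOfFSMFFType2024 D)
    (hD₂ : IsOfFSMFFType2024 D₂) : (ofFunctor Φ F).Thm42i (ofFunctor Φ₂ F₂) Ψ := fun hT =>
  thm42i_of_perfectSetting Ψ (setting_of_isOfFSMFFType2024 Ψ hF hF₂ hperf hperf₂ hpf hpf₂ hD hD₂ hT) hT

/-- **Theorem 4.2 (ii) AS TYPED over bases of FSMFF-type (revised), perfect-type case — NO Thm. 3.4 / Thm. 4.2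
hypothesis left** (supersedes the conditional `thm42ii_of_perfectType_of_isOfFSMFFType2024`, abc-iut-w4-d088,
whose remaining hypothesis "`Ψ`, `Ψ⁻¹` preserve primary pre-steps" is row L07).
[cite: MochizukiFrdI2008, Thm. 4.2 (ii) p.77] [cite: MochizukiFrdIComments2024, (28) p.3] -/
theorem thm42ii_of_perfectType_of_isOfFSMFFType2024' (hF : PreFrobenioid.IsFrobenioid F)
    (hF₂ : PreFrobenioid.IsFrobenioid F₂) (hperf : PreFrobenioid.IsOfPerfectType F)
    (hperf₂ : PreFrobenioid.IsOfPerfectType F₂) (hpf : Objectwise (fun M _ => IsPerfFactorial M) Φ)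
    (hpf₂ : Objectwise (fun M _ => IsPerfFactorial M) Φ₂) (hD : IsOfFSMFFType2024 D)
    (hD₂ : IsOfFSMFFType2024 D₂) : (ofFunctor Φ F).Thm42ii (ofFunctor Φ₂ F₂) Ψ := fun hT =>
  thm42ii_of_perfectSetting Ψ (setting_of_isOfFSMFFType2024 Ψ hF hF₂ hperf hperf₂ hpf hpf₂ hD hD₂ hT) hT

/-- **Theorem 4.2 (iii) AS TYPED over bases of FSMFF-type (revised), perfect-type case**, for ANY family `e`
satisfying the two clauses of (ii) — NO Thm. 3.4 / Thm. 4.2 (i) hypothesis left (supersedes the conditional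
`thm42iii_of_isOfFSMFFType2024`, abc-iut-w4-d088, in the perfect-type case).
[cite: MochizukiFrdI2008, Thm. 4.2 (iii) p.78] [cite: MochizukiFrdIComments2024, (28) p.3] -/
theorem thm42iii_of_perfectType_of_isOfFSMFFType2024' (hF : PreFrobenioid.IsFrobenioid F)
    (hF₂ : PreFrobenioid.IsFrobenioid F₂) (hperf : PreFrobenioid.IsOfPerfectType F)
    (hperf₂ : PreFrobenioid.IsOfPerfectType F₂) (hpf : Objectwise (fun M _ => IsPerfFactorial M) Φ)
    (hpf₂ : Objectwise (fun M _ => IsPerfFactorial M) Φ₂) (hD : IsOfFSMFFType2024 D)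
    (hD₂ : IsOfFSMFFType2024 D₂)
    (e : ∀ A : C, Primes (Φ.obj (op (PreFrobenioid.baseObj F A))) ≃
      Primes (Φ₂.obj (op (PreFrobenioid.baseObj F₂ (Ψ.functor.obj A)))))
    (he : ∀ (A : C) (𝔭 : Primes (Φ.obj (op (PreFrobenioid.baseObj F A)))),
      (∀ ⦃B : C⦄ (φ : A ⟶ B), PreFrobenioid.IsCoAngularPreStep F φ →
          (PreFrobenioid.Div F φ ∈ 𝔭.submonoid ↔
            PreFrobenioid.Div F₂ (Ψ.functor.map φ) ∈ (e A 𝔭).submonoid)) ∧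
        ∀ ⦃B : C⦄ (ψ : B ⟶ A), PreFrobenioid.IsCoAngularPreStep F ψ →
          ((∃ y ∈ 𝔭.submonoid, Frobenioids.pull Φ (PreFrobenioid.Base F ψ) y = PreFrobenioid.Div F ψ) ↔
            ∃ y ∈ (e A 𝔭).submonoid, Frobenioids.pull Φ₂ (PreFrobenioid.Base F₂ (Ψ.functor.map ψ)) y =
              PreFrobenioid.Div F₂ (Ψ.functor.map ψ))) :
    (ofFunctor Φ F).Thm42iii (ofFunctor Φ₂ F₂) Ψ e := fun hT =>
  thm42iii_of_perfectSetting Ψ (setting_of_isOfFSMFFType2024 Ψ hF hF₂ hperf hperf₂ hpf hpf₂ hD hD₂ hT) e he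
    hT

/-- **Theorem 4.2 (ii) and (iii) TOGETHER over bases of FSMFF-type (revised), perfect-type case**: the unique
family `Ψ^Prime` of (ii) exists and, for IT, the monoid isomorphisms of (iii) exist at every
Div-Frobenius-trivial object — no family `e` is assumed. [cite: MochizukiFrdI2008, Thm. 4.2 (ii)(iii) p.78]
[cite: MochizukiFrdIComments2024, (28) p.3] -/
theorem thm42ii_iii_of_perfectType_of_isOfFSMFFType2024 (hF : PreFrobenioid.IsFrobenioid F)
    (hF₂ : PreFrobenioid.IsFrobenioid F₂) (hperf : PreFrobenioid.IsOfPerfectType F)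
    (hperf₂ : PreFrobenioid.IsOfPerfectType F₂) (hpf : Objectwise (fun M _ => IsPerfFactorial M) Φ)
    (hpf₂ : Objectwise (fun M _ => IsPerfFactorial M) Φ₂) (hD : IsOfFSMFFType2024 D)
    (hD₂ : IsOfFSMFFType2024 D₂) (hT : Thm42Setting (ofFunctor Φ F) (ofFunctor Φ₂ F₂)) :
    ∃ e : ∀ A : C, Primes (Φ.obj (op (PreFrobenioid.baseObj F A))) ≃
        Primes (Φ₂.obj (op (PreFrobenioid.baseObj F₂ (Ψ.functor.obj A)))),
      (∀ (A : C) (𝔭 : Primes (Φ.obj (op (PreFrobenioid.baseObj F A)))),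
        (∀ ⦃B : C⦄ (φ : A ⟶ B), PreFrobenioid.IsCoAngularPreStep F φ →
            (PreFrobenioid.Div F φ ∈ 𝔭.submonoid ↔
              PreFrobenioid.Div F₂ (Ψ.functor.map φ) ∈ (e A 𝔭).submonoid)) ∧
          ∀ ⦃B : C⦄ (ψ : B ⟶ A), PreFrobenioid.IsCoAngularPreStep F ψ →
            ((∃ y ∈ 𝔭.submonoid, Frobenioids.pull Φ (PreFrobenioid.Base F ψ) y = PreFrobenioid.Div F ψ) ↔
              ∃ y ∈ (e A 𝔭).submonoid, Frobenioids.pull Φ₂ (PreFrobenioid.Base F₂ (Ψ.functor.map ψ)) y =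
                PreFrobenioid.Div F₂ (Ψ.functor.map ψ))) ∧
      (ofFunctor Φ F).Thm42iii (ofFunctor Φ₂ F₂) Ψ e :=
  have histr : PreFrobenioid.IsOfIsotropicType F := (ofFunctor_isOfIsotropicType F).mp hT.isotropic.1
  have histr₂ : PreFrobenioid.IsOfIsotropicType F₂ := (ofFunctor_isOfIsotropicType F₂).mp hT.isotropic.2
  thm42ii_iii_of_perfectType_of_preservesPreSteps Ψ hF hF₂ hperf hperf₂ hpf hpf₂
    (fun _ _ _ hφ => FrdI.isPreStep_map_of_isOfFSMFFType2024 hF hF₂ histr histr₂ hD hD₂ Ψ hφ)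
    (fun _ _ _ hφ => FrdI.isPreStep_map_of_isOfFSMFFType2024 hF₂ hF histr₂ histr hD₂ hD Ψ.symm hφ) hT

end PreFrobenioidData

end Literature.AlgebraicGeometry.Frobenioids
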